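import Summits.KontsevichZagierPeriods.KontsevichZagierPeriods.Theses.IsogenyCertificates
import Summits.KontsevichZagierPeriods.KontsevichZagierPeriods.Theorems.XMapKernel.Negative.Core
import Literature.NumberTheory.Transcendental.KZLogCalculusProofs

/-!
# `BiellipticRealPeriodCell` (stmt-KontsevichZagierPeriods-18685): negative side — strength, hypothesis mutation, shape of a kill

Negative-side support for the rank-8 crux `BiellipticRealPeriodCell` of route `IsogenyCertificates`
(cdisprove unit `refuter-cdisprove-stmt-KontsevichZagierPeriods-18685-0`; running commentary in the crux
work file `Cruxes/BiellipticRealPeriodCell/Disproof.lean`). The crux: Conjecture 1 of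
[Kontsevich–Zagier 2001, §1.2] in kernel form on the BIELLIPTIC sector — every value-`0` formal
`ℤ`-combination of representations `[K, (a₀+a₁x)/√G(x²)]` (`G ∈ ℚ[u]` cubic, `G(x²)` squarefree, `K` a
bounded connected component of `{G(x²) > 0}`) lies in `KZ.relations`. Nothing here refutes it. All
kernel statements are written as inequalities of subgroups of `KZ.FormalRep`,
`closure S ⊓ ker eval ≤ relations` (`forall_iff_inf_le`), so that no proposition is defined and no
theorem has a route decl or its negation as its conclusion. Recorded, as importable theorems:

* §0 vocabulary (no definitions: every generating set is written out verbatim): `crux_iff` (`Iff.rfl`),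
  `crux_iff_inf_le`, and the closure manipulations every line uses (`inf_le_mono`,
  `inf_le_of_subset_sup` — the transfer principle: generators congruent mod relations to a known cell
  inherit its kernel statement);
* §1 STRENGTH: `summit_iff_ker_le` + `inf_le_of_ker_le` + `crux_iff_inf_le`: the summit (= the kernel
  conjecture `ker eval ≤ relations`) implies the crux, and so does the sibling crux
  `GenusTwoRealPeriodCell` (`biellGens_subset_genusTwoGens` + `inf_le_mono`): a Lean refutation
  of this crux is a refutation of the formalised period conjecture — there is no statement-level kill;
* §2 HYPOTHESIS MUTATION: dropping any one of the sector hypotheses `IsBounded`, `Squarefree`,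
  `natDegree = 3` gives a generating set between `biellGens` and everything
  (`biellGens_subset_without*Gens`), so the weakened statement is sandwiched between the crux and
  Conjecture 1 (`inf_le_mono`, `inf_le_of_ker_le`) and NO `_false_without_` theorem for these
  hypotheses exists short of `¬` Conjecture 1 — they are METHOD-bearing (which integrals the cell
  must digest), not truth-bearing; dropping `0 < G(q²)` changes nothing at all
  (`withoutPos_inf_le_iff`: the extra generators have EMPTY domain and are relations);
* §3 the SHAPE of any refutation (`not_inf_le_iff`, `not_inf_le_of_separating_invariant`);
* §4 what the hypotheses buy, as the small facts the lines consume (`aeval_comp_X_sq`,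
  `aeval_comp_X_sq_neg`, `natDegree_comp_X_sq`, `coeff_zero_ne_zero_of_squarefree`: `G(0) ≠ 0`, so
  `0` is never an end of a component and the reversed cubic `u³G(1/u)` is again a cubic).

Sources: M. Kontsevich, D. Zagier, *Periods* (2001), §§1.1–1.2 (rules and Conjecture 1);
A. Huber, S. Müller-Stach, *Periods and Nori Motives* (2017), §13.1–13.2 (kernel form).
-/

noncomputable section

namespace Summit.KontsevichZagierPeriods.IsogenyCertificates.BiellipticRealPeriodCellNegative

open Literature.NumberTheory.Transcendental
open Summit.KontsevichZagierPeriods.KontsevichZagierPeriods.Theses.IsogenyCertificates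
open Summit.KontsevichZagierPeriods.XMapKernel.Negative (summit_iff_kzKernelConjecture)
open Set MeasureTheory Polynomial

/-! ### §0 Vocabulary -/

/-- The crux, unfolded: the kernel statement on the bielliptic sector. [folklore] -/
theorem crux_iff : BiellipticRealPeriodCell ↔
    ∀ c ∈ AddSubgroup.closure
      {d : KZ.FormalRep | ∃ (G : Polynomial ℚ) (q a₀ a₁ : ℚ) (r : KZ.IntegralRep 1), G.natDegree = 3 ∧
    Squarefree (G.comp (Polynomial.X ^ 2)) ∧
    0 < Polynomial.aeval (q : ℝ) (G.comp (Polynomial.X ^ 2)) ∧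
    Bornology.IsBounded (connectedComponentIn {y : ℝ | 0 < Polynomial.aeval y (G.comp (Polynomial.X ^ 2))} (q : ℝ)) ∧
    r.domain = {x | x 0 ∈ connectedComponentIn {y : ℝ | 0 < Polynomial.aeval y (G.comp (Polynomial.X ^ 2))} (q : ℝ)} ∧
    Set.EqOn r.integrand (fun x => ((a₀ : ℝ) + (a₁ : ℝ) * x 0) /
      Real.sqrt (Polynomial.aeval (x 0) (G.comp (Polynomial.X ^ 2)))) r.domain ∧
    d = KZ.of r}, KZ.eval c = 0 → c ∈ KZ.relations := Iff.rfl

/-- A sector kernel statement is an inequality of subgroups: `closure S ⊓ ker eval ≤ relations`.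
[folklore] -/
theorem forall_iff_inf_le (S : Set KZ.FormalRep) :
    (∀ c ∈ AddSubgroup.closure S, KZ.eval c = 0 → c ∈ KZ.relations) ↔
      AddSubgroup.closure S ⊓ KZ.eval.ker ≤ KZ.relations := by
  constructor
  · intro h c hc
    exact h c (AddSubgroup.mem_inf.1 hc).1 (AddMonoidHom.mem_ker.1 (AddSubgroup.mem_inf.1 hc).2)
  · intro h c hc h0
    exact h (AddSubgroup.mem_inf.2 ⟨hc, AddMonoidHom.mem_ker.2 h0⟩)

/-- The crux as an inequality of subgroups of `KZ.FormalRep`. [folklore] -/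
theorem crux_iff_inf_le : BiellipticRealPeriodCell ↔
    AddSubgroup.closure
      {d : KZ.FormalRep | ∃ (G : Polynomial ℚ) (q a₀ a₁ : ℚ) (r : KZ.IntegralRep 1), G.natDegree = 3 ∧
    Squarefree (G.comp (Polynomial.X ^ 2)) ∧
    0 < Polynomial.aeval (q : ℝ) (G.comp (Polynomial.X ^ 2)) ∧
    Bornology.IsBounded (connectedComponentIn {y : ℝ | 0 < Polynomial.aeval y (G.comp (Polynomial.X ^ 2))} (q : ℝ)) ∧
    r.domain = {x | x 0 ∈ connectedComponentIn {y : ℝ | 0 < Polynomial.aeval y (G.comp (Polynomial.X ^ 2))} (q : ℝ)} ∧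
    Set.EqOn r.integrand (fun x => ((a₀ : ℝ) + (a₁ : ℝ) * x 0) /
      Real.sqrt (Polynomial.aeval (x 0) (G.comp (Polynomial.X ^ 2)))) r.domain ∧
    d = KZ.of r} ⊓ KZ.eval.ker ≤ KZ.relations :=
  forall_iff_inf_le _

/-- The kernel conjecture (kernel form of Conjecture 1) as an inequality: `ker eval ≤ relations`.
[cite: KontsevichZagier2001, §1.2 Conjecture 1] -/
theorem kzKernelConjecture_iff_ker_le : KZKernelConjecture ↔ KZ.eval.ker ≤ KZ.relations :=
  ⟨fun h _ hc => h _ (AddMonoidHom.mem_ker.1 hc), fun h _ hc => h (AddMonoidHom.mem_ker.2 hc)⟩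

/-- The summit statement as an inequality: `ker eval ≤ relations` (tree:
`kzKernelConjecture_iff_isRational`). [cite: KontsevichZagier2001, §1.2 Conjecture 1] -/
theorem summit_iff_ker_le : _root_.KontsevichZagierPeriods ↔ KZ.eval.ker ≤ KZ.relations :=
  summit_iff_kzKernelConjecture.trans kzKernelConjecture_iff_ker_le

/-- Sector kernel statements are antitone in the generating set. [folklore] -/
theorem inf_le_mono {S T : Set KZ.FormalRep} (hST : S ⊆ T)
    (hT : AddSubgroup.closure T ⊓ KZ.eval.ker ≤ KZ.relations) :
    AddSubgroup.closure S ⊓ KZ.eval.ker ≤ KZ.relations :=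
  le_trans (inf_le_inf_right _ (AddSubgroup.closure_mono hST)) hT

/-- The kernel conjecture gives every sector kernel statement. [folklore] -/
theorem inf_le_of_ker_le (S : Set KZ.FormalRep) (h : KZ.eval.ker ≤ KZ.relations) :
    AddSubgroup.closure S ⊓ KZ.eval.ker ≤ KZ.relations :=
  le_trans inf_le_right h

/-- **Transfer principle.** If every generator of `T` is congruent modulo `KZ.relations` to an element
of `closure S`, then the kernel statement on `S` gives the kernel statement on `T` (soundness
`KZ.relations_le_ker_eval_holds` moves the value-`0` hypothesis across). [folklore] -/
theorem inf_le_of_subset_sup {S T : Set KZ.FormalRep}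
    (hT : T ⊆ ↑(AddSubgroup.closure S ⊔ KZ.relations))
    (hS : AddSubgroup.closure S ⊓ KZ.eval.ker ≤ KZ.relations) :
    AddSubgroup.closure T ⊓ KZ.eval.ker ≤ KZ.relations := by
  intro c hc
  obtain ⟨hcT, hc0⟩ := AddSubgroup.mem_inf.1 hc
  have hc' : c ∈ AddSubgroup.closure S ⊔ KZ.relations :=
    (AddSubgroup.closure_le (K := AddSubgroup.closure S ⊔ KZ.relations)).2 hT hcT
  obtain ⟨b, hb, ρ, hρ, rfl⟩ := AddSubgroup.mem_sup.1 hc'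
  have hρ0 : KZ.eval ρ = 0 := AddMonoidHom.mem_ker.1 (KZ.relations_le_ker_eval_holds hρ)
  have hb0 : KZ.eval b = 0 := by
    have h0 := AddMonoidHom.mem_ker.1 hc0
    rw [map_add, hρ0, add_zero] at h0
    exact h0
  exact KZ.relations.add_mem (hS (AddSubgroup.mem_inf.2 ⟨hb, AddMonoidHom.mem_ker.2 hb0⟩)) hρ

/-! ### §1 Strength: the summit implies the crux; so does the genus-two cell -/

/-- `aeval y (G ∘ X²) = aeval (y²) G`. [folklore] -/
theorem aeval_comp_X_sq (G : Polynomial ℚ) (y : ℝ) :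
    Polynomial.aeval y (G.comp (Polynomial.X ^ 2)) = Polynomial.aeval (y ^ 2) G := by
  rw [Polynomial.aeval_comp, map_pow, Polynomial.aeval_X]

/-- The bielliptic sextic is even: `G((−y)²) = G(y²)`. [folklore] -/
theorem aeval_comp_X_sq_neg (G : Polynomial ℚ) (y : ℝ) :
    Polynomial.aeval (-y) (G.comp (Polynomial.X ^ 2)) = Polynomial.aeval y (G.comp (Polynomial.X ^ 2)) := by
  rw [aeval_comp_X_sq, aeval_comp_X_sq, neg_sq]

/-- `deg (G ∘ X²) = 2 · deg G`; for a cubic `G` the sextic has degree `6`. [folklore] -/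
theorem natDegree_comp_X_sq (G : Polynomial ℚ) :
    (G.comp (Polynomial.X ^ 2)).natDegree = G.natDegree * 2 := by
  rw [Polynomial.natDegree_comp, Polynomial.natDegree_X_pow]

/-- The bielliptic generators are generators of the genus-two sector (`F := G ∘ X²` has degree `6`,
is squarefree, and the domain/integrand clauses agree; boundedness is simply forgotten), so
`GenusTwoRealPeriodCell ⇒ BiellipticRealPeriodCell` by `inf_le_mono` (the planner's `cell_mono`).
[folklore] -/
theorem biellGens_subset_genusTwoGens :
    {d : KZ.FormalRep | ∃ (G : Polynomial ℚ) (q a₀ a₁ : ℚ) (r : KZ.IntegralRep 1), G.natDegree = 3 ∧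
    Squarefree (G.comp (Polynomial.X ^ 2)) ∧
    0 < Polynomial.aeval (q : ℝ) (G.comp (Polynomial.X ^ 2)) ∧
    Bornology.IsBounded (connectedComponentIn {y : ℝ | 0 < Polynomial.aeval y (G.comp (Polynomial.X ^ 2))} (q : ℝ)) ∧
    r.domain = {x | x 0 ∈ connectedComponentIn {y : ℝ | 0 < Polynomial.aeval y (G.comp (Polynomial.X ^ 2))} (q : ℝ)} ∧
    Set.EqOn r.integrand (fun x => ((a₀ : ℝ) + (a₁ : ℝ) * x 0) /
      Real.sqrt (Polynomial.aeval (x 0) (G.comp (Polynomial.X ^ 2)))) r.domain ∧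
    d = KZ.of r} ⊆
    {d : KZ.FormalRep | ∃ (F : Polynomial ℚ) (q a₀ a₁ : ℚ) (r : KZ.IntegralRep 1), Squarefree F ∧
      (F.natDegree = 5 ∨ F.natDegree = 6) ∧ 0 < Polynomial.aeval (q : ℝ) F ∧
      r.domain = {x | x 0 ∈ connectedComponentIn {y : ℝ | 0 < Polynomial.aeval y F} (q : ℝ)} ∧
      Set.EqOn r.integrand (fun x => ((a₀ : ℝ) + (a₁ : ℝ) * x 0) / Real.sqrt (Polynomial.aeval (x 0) F)) r.domain ∧
      d = KZ.of r} := by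
  rintro d ⟨G, q, a₀, a₁, r, hdeg, hsq, hpos, -, hdom, hint, rfl⟩
  refine ⟨G.comp (Polynomial.X ^ 2), q, a₀, a₁, r, hsq, Or.inr ?_, hpos, hdom, hint, rfl⟩
  rw [natDegree_comp_X_sq, hdeg]

/-! ### §2 Hypothesis mutation: every weakening is sandwiched between the crux and Conjecture 1 -/

/-- `biellGens ⊆ withoutBoundedGens`: with `inf_le_mono` / `inf_le_of_ker_le` the weakened statement
`closure withoutBoundedGens ⊓ ker eval ≤ relations` is sandwiched between the crux and Conjecture 1;
a `_false_without_IsBounded` theorem would refute the period conjecture. [folklore] -/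
theorem biellGens_subset_withoutBoundedGens :
    {d : KZ.FormalRep | ∃ (G : Polynomial ℚ) (q a₀ a₁ : ℚ) (r : KZ.IntegralRep 1), G.natDegree = 3 ∧
    Squarefree (G.comp (Polynomial.X ^ 2)) ∧
    0 < Polynomial.aeval (q : ℝ) (G.comp (Polynomial.X ^ 2)) ∧
    Bornology.IsBounded (connectedComponentIn {y : ℝ | 0 < Polynomial.aeval y (G.comp (Polynomial.X ^ 2))} (q : ℝ)) ∧
    r.domain = {x | x 0 ∈ connectedComponentIn {y : ℝ | 0 < Polynomial.aeval y (G.comp (Polynomial.X ^ 2))} (q : ℝ)} ∧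
    Set.EqOn r.integrand (fun x => ((a₀ : ℝ) + (a₁ : ℝ) * x 0) /
      Real.sqrt (Polynomial.aeval (x 0) (G.comp (Polynomial.X ^ 2)))) r.domain ∧
    d = KZ.of r} ⊆
    {d : KZ.FormalRep | ∃ (G : Polynomial ℚ) (q a₀ a₁ : ℚ) (r : KZ.IntegralRep 1), G.natDegree = 3 ∧
    Squarefree (G.comp (Polynomial.X ^ 2)) ∧
    0 < Polynomial.aeval (q : ℝ) (G.comp (Polynomial.X ^ 2)) ∧
    r.domain = {x | x 0 ∈ connectedComponentIn {y : ℝ | 0 < Polynomial.aeval y (G.comp (Polynomial.X ^ 2))} (q : ℝ)} ∧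
    Set.EqOn r.integrand (fun x => ((a₀ : ℝ) + (a₁ : ℝ) * x 0) /
      Real.sqrt (Polynomial.aeval (x 0) (G.comp (Polynomial.X ^ 2)))) r.domain ∧
    d = KZ.of r} := by
  rintro d ⟨G, q, a₀, a₁, r, h1, h2, h3, -, h5, h6, h7⟩
  exact ⟨G, q, a₀, a₁, r, h1, h2, h3, h5, h6, h7⟩

/-- `biellGens ⊆ withoutSquarefreeGens` (same sandwich). [folklore] -/
theorem biellGens_subset_withoutSquarefreeGens :
    {d : KZ.FormalRep | ∃ (G : Polynomial ℚ) (q a₀ a₁ : ℚ) (r : KZ.IntegralRep 1), G.natDegree = 3 ∧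
    Squarefree (G.comp (Polynomial.X ^ 2)) ∧
    0 < Polynomial.aeval (q : ℝ) (G.comp (Polynomial.X ^ 2)) ∧
    Bornology.IsBounded (connectedComponentIn {y : ℝ | 0 < Polynomial.aeval y (G.comp (Polynomial.X ^ 2))} (q : ℝ)) ∧
    r.domain = {x | x 0 ∈ connectedComponentIn {y : ℝ | 0 < Polynomial.aeval y (G.comp (Polynomial.X ^ 2))} (q : ℝ)} ∧
    Set.EqOn r.integrand (fun x => ((a₀ : ℝ) + (a₁ : ℝ) * x 0) /
      Real.sqrt (Polynomial.aeval (x 0) (G.comp (Polynomial.X ^ 2)))) r.domain ∧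
    d = KZ.of r} ⊆
    {d : KZ.FormalRep | ∃ (G : Polynomial ℚ) (q a₀ a₁ : ℚ) (r : KZ.IntegralRep 1), G.natDegree = 3 ∧
    0 < Polynomial.aeval (q : ℝ) (G.comp (Polynomial.X ^ 2)) ∧
    Bornology.IsBounded (connectedComponentIn {y : ℝ | 0 < Polynomial.aeval y (G.comp (Polynomial.X ^ 2))} (q : ℝ)) ∧
    r.domain = {x | x 0 ∈ connectedComponentIn {y : ℝ | 0 < Polynomial.aeval y (G.comp (Polynomial.X ^ 2))} (q : ℝ)} ∧
    Set.EqOn r.integrand (fun x => ((a₀ : ℝ) + (a₁ : ℝ) * x 0) /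
      Real.sqrt (Polynomial.aeval (x 0) (G.comp (Polynomial.X ^ 2)))) r.domain ∧
    d = KZ.of r} := by
  rintro d ⟨G, q, a₀, a₁, r, h1, -, h3, h4, h5, h6, h7⟩
  exact ⟨G, q, a₀, a₁, r, h1, h3, h4, h5, h6, h7⟩

/-- `biellGens ⊆ withoutDegreeGens` (same sandwich). [folklore] -/
theorem biellGens_subset_withoutDegreeGens :
    {d : KZ.FormalRep | ∃ (G : Polynomial ℚ) (q a₀ a₁ : ℚ) (r : KZ.IntegralRep 1), G.natDegree = 3 ∧
    Squarefree (G.comp (Polynomial.X ^ 2)) ∧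
    0 < Polynomial.aeval (q : ℝ) (G.comp (Polynomial.X ^ 2)) ∧
    Bornology.IsBounded (connectedComponentIn {y : ℝ | 0 < Polynomial.aeval y (G.comp (Polynomial.X ^ 2))} (q : ℝ)) ∧
    r.domain = {x | x 0 ∈ connectedComponentIn {y : ℝ | 0 < Polynomial.aeval y (G.comp (Polynomial.X ^ 2))} (q : ℝ)} ∧
    Set.EqOn r.integrand (fun x => ((a₀ : ℝ) + (a₁ : ℝ) * x 0) /
      Real.sqrt (Polynomial.aeval (x 0) (G.comp (Polynomial.X ^ 2)))) r.domain ∧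
    d = KZ.of r} ⊆
    {d : KZ.FormalRep | ∃ (G : Polynomial ℚ) (q a₀ a₁ : ℚ) (r : KZ.IntegralRep 1), Squarefree (G.comp (Polynomial.X ^ 2)) ∧
    0 < Polynomial.aeval (q : ℝ) (G.comp (Polynomial.X ^ 2)) ∧
    Bornology.IsBounded (connectedComponentIn {y : ℝ | 0 < Polynomial.aeval y (G.comp (Polynomial.X ^ 2))} (q : ℝ)) ∧
    r.domain = {x | x 0 ∈ connectedComponentIn {y : ℝ | 0 < Polynomial.aeval y (G.comp (Polynomial.X ^ 2))} (q : ℝ)} ∧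
    Set.EqOn r.integrand (fun x => ((a₀ : ℝ) + (a₁ : ℝ) * x 0) /
      Real.sqrt (Polynomial.aeval (x 0) (G.comp (Polynomial.X ^ 2)))) r.domain ∧
    d = KZ.of r} := by
  rintro d ⟨G, q, a₀, a₁, r, -, h2, h3, h4, h5, h6, h7⟩
  exact ⟨G, q, a₀, a₁, r, h2, h3, h4, h5, h6, h7⟩

/-- `biellGens ⊆ withoutPosGens`. [folklore] -/
theorem biellGens_subset_withoutPosGens :
    {d : KZ.FormalRep | ∃ (G : Polynomial ℚ) (q a₀ a₁ : ℚ) (r : KZ.IntegralRep 1), G.natDegree = 3 ∧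
    Squarefree (G.comp (Polynomial.X ^ 2)) ∧
    0 < Polynomial.aeval (q : ℝ) (G.comp (Polynomial.X ^ 2)) ∧
    Bornology.IsBounded (connectedComponentIn {y : ℝ | 0 < Polynomial.aeval y (G.comp (Polynomial.X ^ 2))} (q : ℝ)) ∧
    r.domain = {x | x 0 ∈ connectedComponentIn {y : ℝ | 0 < Polynomial.aeval y (G.comp (Polynomial.X ^ 2))} (q : ℝ)} ∧
    Set.EqOn r.integrand (fun x => ((a₀ : ℝ) + (a₁ : ℝ) * x 0) /
      Real.sqrt (Polynomial.aeval (x 0) (G.comp (Polynomial.X ^ 2)))) r.domain ∧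
    d = KZ.of r} ⊆
    {d : KZ.FormalRep | ∃ (G : Polynomial ℚ) (q a₀ a₁ : ℚ) (r : KZ.IntegralRep 1), G.natDegree = 3 ∧
    Squarefree (G.comp (Polynomial.X ^ 2)) ∧
    Bornology.IsBounded (connectedComponentIn {y : ℝ | 0 < Polynomial.aeval y (G.comp (Polynomial.X ^ 2))} (q : ℝ)) ∧
    r.domain = {x | x 0 ∈ connectedComponentIn {y : ℝ | 0 < Polynomial.aeval y (G.comp (Polynomial.X ^ 2))} (q : ℝ)} ∧
    Set.EqOn r.integrand (fun x => ((a₀ : ℝ) + (a₁ : ℝ) * x 0) /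
      Real.sqrt (Polynomial.aeval (x 0) (G.comp (Polynomial.X ^ 2)))) r.domain ∧
    d = KZ.of r} := by
  rintro d ⟨G, q, a₀, a₁, r, h1, h2, -, h4, h5, h6, h7⟩
  exact ⟨G, q, a₀, a₁, r, h1, h2, h4, h5, h6, h7⟩

/-- The generators gained by dropping `0 < G(q²)` are congruent mod relations to bielliptic ones: if
`G(q²) ≤ 0` then `q ∉ {G(x²) > 0}`, the component through `q` is empty
(`connectedComponentIn_eq_empty`), the representation has empty domain and is a relation on its own
(`KZ.of_mem_relations_of_volume_eq_zero`). [folklore] -/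
theorem withoutPosGens_subset_sup :
    {d : KZ.FormalRep | ∃ (G : Polynomial ℚ) (q a₀ a₁ : ℚ) (r : KZ.IntegralRep 1), G.natDegree = 3 ∧
    Squarefree (G.comp (Polynomial.X ^ 2)) ∧
    Bornology.IsBounded (connectedComponentIn {y : ℝ | 0 < Polynomial.aeval y (G.comp (Polynomial.X ^ 2))} (q : ℝ)) ∧
    r.domain = {x | x 0 ∈ connectedComponentIn {y : ℝ | 0 < Polynomial.aeval y (G.comp (Polynomial.X ^ 2))} (q : ℝ)} ∧
    Set.EqOn r.integrand (fun x => ((a₀ : ℝ) + (a₁ : ℝ) * x 0) /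
      Real.sqrt (Polynomial.aeval (x 0) (G.comp (Polynomial.X ^ 2)))) r.domain ∧
    d = KZ.of r} ⊆
    ↑(AddSubgroup.closure
      {d : KZ.FormalRep | ∃ (G : Polynomial ℚ) (q a₀ a₁ : ℚ) (r : KZ.IntegralRep 1), G.natDegree = 3 ∧
    Squarefree (G.comp (Polynomial.X ^ 2)) ∧
    0 < Polynomial.aeval (q : ℝ) (G.comp (Polynomial.X ^ 2)) ∧
    Bornology.IsBounded (connectedComponentIn {y : ℝ | 0 < Polynomial.aeval y (G.comp (Polynomial.X ^ 2))} (q : ℝ)) ∧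
    r.domain = {x | x 0 ∈ connectedComponentIn {y : ℝ | 0 < Polynomial.aeval y (G.comp (Polynomial.X ^ 2))} (q : ℝ)} ∧
    Set.EqOn r.integrand (fun x => ((a₀ : ℝ) + (a₁ : ℝ) * x 0) /
      Real.sqrt (Polynomial.aeval (x 0) (G.comp (Polynomial.X ^ 2)))) r.domain ∧
    d = KZ.of r} ⊔ KZ.relations) := by
  rintro d ⟨G, q, a₀, a₁, r, h1, h2, h4, h5, h6, rfl⟩
  by_cases hpos : 0 < Polynomial.aeval (q : ℝ) (G.comp (Polynomial.X ^ 2))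
  · exact AddSubgroup.mem_sup_left
      (AddSubgroup.subset_closure ⟨G, q, a₀, a₁, r, h1, h2, hpos, h4, h5, h6, rfl⟩)
  · refine AddSubgroup.mem_sup_right (KZ.of_mem_relations_of_volume_eq_zero r ?_)
    have hempty : connectedComponentIn {y : ℝ | 0 < Polynomial.aeval y (G.comp (Polynomial.X ^ 2))} (q : ℝ) = ∅ :=
      connectedComponentIn_eq_empty hpos
    simp [h5, hempty]

/-- **The positivity hypothesis `0 < G(q²)` is decoration**: dropping it does not change the
statement. [folklore] -/
theorem withoutPos_inf_le_iff :
    AddSubgroup.closure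
      {d : KZ.FormalRep | ∃ (G : Polynomial ℚ) (q a₀ a₁ : ℚ) (r : KZ.IntegralRep 1), G.natDegree = 3 ∧
    Squarefree (G.comp (Polynomial.X ^ 2)) ∧
    Bornology.IsBounded (connectedComponentIn {y : ℝ | 0 < Polynomial.aeval y (G.comp (Polynomial.X ^ 2))} (q : ℝ)) ∧
    r.domain = {x | x 0 ∈ connectedComponentIn {y : ℝ | 0 < Polynomial.aeval y (G.comp (Polynomial.X ^ 2))} (q : ℝ)} ∧
    Set.EqOn r.integrand (fun x => ((a₀ : ℝ) + (a₁ : ℝ) * x 0) /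
      Real.sqrt (Polynomial.aeval (x 0) (G.comp (Polynomial.X ^ 2)))) r.domain ∧
    d = KZ.of r} ⊓ KZ.eval.ker ≤ KZ.relations ↔
      AddSubgroup.closure
      {d : KZ.FormalRep | ∃ (G : Polynomial ℚ) (q a₀ a₁ : ℚ) (r : KZ.IntegralRep 1), G.natDegree = 3 ∧
    Squarefree (G.comp (Polynomial.X ^ 2)) ∧
    0 < Polynomial.aeval (q : ℝ) (G.comp (Polynomial.X ^ 2)) ∧
    Bornology.IsBounded (connectedComponentIn {y : ℝ | 0 < Polynomial.aeval y (G.comp (Polynomial.X ^ 2))} (q : ℝ)) ∧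
    r.domain = {x | x 0 ∈ connectedComponentIn {y : ℝ | 0 < Polynomial.aeval y (G.comp (Polynomial.X ^ 2))} (q : ℝ)} ∧
    Set.EqOn r.integrand (fun x => ((a₀ : ℝ) + (a₁ : ℝ) * x 0) /
      Real.sqrt (Polynomial.aeval (x 0) (G.comp (Polynomial.X ^ 2)))) r.domain ∧
    d = KZ.of r} ⊓ KZ.eval.ker ≤ KZ.relations :=
  ⟨inf_le_mono biellGens_subset_withoutPosGens, inf_le_of_subset_sup withoutPosGens_subset_sup⟩

/-- The same, against the crux by name: `BiellipticRealPeriodCell` is equivalent to its version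
without the positivity clause. [folklore] -/
theorem crux_iff_withoutPos_inf_le : BiellipticRealPeriodCell ↔
    AddSubgroup.closure
      {d : KZ.FormalRep | ∃ (G : Polynomial ℚ) (q a₀ a₁ : ℚ) (r : KZ.IntegralRep 1), G.natDegree = 3 ∧
    Squarefree (G.comp (Polynomial.X ^ 2)) ∧
    Bornology.IsBounded (connectedComponentIn {y : ℝ | 0 < Polynomial.aeval y (G.comp (Polynomial.X ^ 2))} (q : ℝ)) ∧
    r.domain = {x | x 0 ∈ connectedComponentIn {y : ℝ | 0 < Polynomial.aeval y (G.comp (Polynomial.X ^ 2))} (q : ℝ)} ∧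
    Set.EqOn r.integrand (fun x => ((a₀ : ℝ) + (a₁ : ℝ) * x 0) /
      Real.sqrt (Polynomial.aeval (x 0) (G.comp (Polynomial.X ^ 2)))) r.domain ∧
    d = KZ.of r} ⊓ KZ.eval.ker ≤ KZ.relations :=
  crux_iff_inf_le.trans withoutPos_inf_le_iff.symm

/-! ### §3 The shape of any refutation -/

/-- A failure of a sector kernel statement is exactly a value-`0` element of the sector that is not
a relation. [folklore] -/
theorem not_inf_le_iff (S : Set KZ.FormalRep) :
    ¬ (AddSubgroup.closure S ⊓ KZ.eval.ker ≤ KZ.relations) ↔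
      ∃ c ∈ AddSubgroup.closure S, KZ.eval c = 0 ∧ c ∉ KZ.relations := by
  rw [← forall_iff_inf_le]
  simp only [not_forall, exists_prop]

/-- **Separating-invariant template.** An additive invariant of formal combinations that kills the
four move sets but not some value-`0` element of the sector refutes the sector kernel statement
(for `S = biellGens`: the crux). None is known: by Huber–Wüstholz every `ℚ̄`-linear relation among
the 1-periods met here is of motivic origin. [folklore] -/
theorem not_inf_le_of_separating_invariant {A : Type*} [AddCommGroup A] (ψ : KZ.FormalRep →+ A)
    (hψ : KZ.relations ≤ ψ.ker) {S : Set KZ.FormalRep} {c : KZ.FormalRep}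
    (hc : c ∈ AddSubgroup.closure S) (h0 : KZ.eval c = 0) (hψc : ψ c ≠ 0) :
    ¬ (AddSubgroup.closure S ⊓ KZ.eval.ker ≤ KZ.relations) :=
  fun h => hψc (AddMonoidHom.mem_ker.1 (hψ (h (AddSubgroup.mem_inf.2 ⟨hc, AddMonoidHom.mem_ker.2 h0⟩))))

/-! ### §4 What the hypotheses buy -/

/-- **`Squarefree (G ∘ X²)` forces `G(0) ≠ 0`**: otherwise `X² ∣ G ∘ X²`. Consequences used by the
lines: `0` is never a root of the sextic (no component ends at `0`), and `u³G(1/u)` is a cubic.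
[folklore] -/
theorem coeff_zero_ne_zero_of_squarefree {G : Polynomial ℚ} (h : Squarefree (G.comp (Polynomial.X ^ 2))) :
    G.coeff 0 ≠ 0 := by
  intro h0
  obtain ⟨H, hH⟩ := Polynomial.X_dvd_iff.2 h0
  have hdvd : Polynomial.X * Polynomial.X ∣ G.comp (Polynomial.X ^ 2) := by
    refine ⟨H.comp (Polynomial.X ^ 2), ?_⟩
    conv_lhs => rw [hH]
    rw [Polynomial.mul_comp, Polynomial.X_comp]
    ring
  exact Polynomial.not_isUnit_X (h Polynomial.X hdvd)

/-- Hence the sextic does not vanish at `0`: `aeval 0 (G ∘ X²) = G(0) ≠ 0`. [folklore] -/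
theorem aeval_zero_comp_X_sq_ne_zero {G : Polynomial ℚ} (h : Squarefree (G.comp (Polynomial.X ^ 2))) :
    Polynomial.aeval (0 : ℝ) (G.comp (Polynomial.X ^ 2)) ≠ 0 := by
  rw [aeval_comp_X_sq, zero_pow two_ne_zero, Polynomial.aeval_def, Polynomial.eval₂_at_zero]
  exact (map_ne_zero_iff _ (algebraMap ℚ ℝ).injective).2 (coeff_zero_ne_zero_of_squarefree h)

/-- And `Squarefree (G ∘ X²)` forces `Squarefree G` (a repeated factor of `G` composes to a repeated
factor of the sextic; units of `ℚ[X]` are the constants, detected by the degree). [folklore] -/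
theorem squarefree_of_squarefree_comp {G : Polynomial ℚ} (h : Squarefree (G.comp (Polynomial.X ^ 2))) :
    Squarefree G := by
  intro p hp
  obtain ⟨H, hH⟩ := hp
  have hdvd : p.comp (Polynomial.X ^ 2) * p.comp (Polynomial.X ^ 2) ∣ G.comp (Polynomial.X ^ 2) :=
    ⟨H.comp (Polynomial.X ^ 2), by rw [hH, Polynomial.mul_comp, Polynomial.mul_comp]⟩
  have hu := h _ hdvd
  rw [Polynomial.isUnit_iff_degree_eq_zero] at hu ⊢
  have hX : (Polynomial.X ^ 2 : Polynomial ℚ).natDegree ≠ 0 := by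
    rw [Polynomial.natDegree_X_pow]; norm_num
  have hnat : (p.comp (Polynomial.X ^ 2)).natDegree = p.natDegree * 2 := by
    rw [Polynomial.natDegree_comp, Polynomial.natDegree_X_pow]
  have hp0 : p ≠ 0 := by
    rintro rfl
    simp at hu
  have hpc0 : p.comp (Polynomial.X ^ 2) ≠ 0 := by
    intro h0; rw [h0] at hu; simp at hu
  rw [Polynomial.degree_eq_natDegree hpc0, hnat] at hu
  rw [Polynomial.degree_eq_natDegree hp0]
  have : p.natDegree * 2 = 0 := by exact_mod_cast hu
  have : p.natDegree = 0 := by omega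
  exact_mod_cast this

end Summit.KontsevichZagierPeriods.IsogenyCertificates.BiellipticRealPeriodCellNegative
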